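import Mathlib
import HarnessLib
import Literature.MathematicalPhysics.QuantumLattice.KohnLuttinger
import Literature.MathematicalPhysics.QuantumLattice.KohnLuttingerLindhardMeasurable
import Summits.HubbardSuperconductivity.HubbardSuperconductivity.Theorems.WeakCouplingBCSWcbcsKohnLuttingerB1gReduction

/-!
# Route `KLProgramme` — support item `MuOfDopingWindow` (stmt-HubbardSuperconductivity-19939):
# convexity of the free Fermi sea and inscribed trapezoids

For the nearest-neighbour band `ε₀ = squareDispersion 1 0` (`ε₀ p = -2 (cos p₀ + cos p₁)`) and `c > 0`
(energy `μ = -2c < 0`, below half filling) the Fermi sea `{ε₀ < μ} ∩ BZ`, read in the coordinates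
`(x, y) = (p₀, p₁) ∈ ℝ × ℝ`, is the set

  `R_c = {(x, y) | |x + y| < π, |x - y| < π, cos x + cos y > c}`

(for `c ≥ 0` the condition `cos x + cos y > c` forces `|x| + |y| < π`, `fermiSeaCoord_subset`).  We prove:

* `convex_fermiSeaCoord` — **`R_c` is CONVEX** for `c > 0`: with `u = (x+y)/2`, `v = (x-y)/2 ∈ (-π/2, π/2)`
  one has `cos x + cos y = 2 cos u cos v`, and `log cos` is concave on `(-π/2, π/2)` (its derivative `-tan`
  is antitone), so `R_c` is a superlevel set of the concave function `log cos u + log cos v` on the open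
  diamond (the tree's `HubbardFermiCurve.strictConvexOn_sqDispersion` covers only the half box `|pᵢ| ≤ π/2`,
  i.e. `μ ≤ -2`; this covers the whole range `-4 < μ < 0`);
* `trapezoid_subset_of_convex` — a symmetric trapezoid `{x ∈ (x₀, x₁], |y| < g(x)}` (`g` affine) whose four
  corners lie in a convex set lies in it; `volume_trapezoid` — its area `(x₁ - x₀)(g x₀ + g x₁)`;
  `trapezoid_union_step` — bookkeeping for disjoint unions of such trapezoids over consecutive intervals;
* `preimage_fermiSeaCoord_subset` / `volume_fermiSeaCoord_le` — transport to momentum space: the volume of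
  `R_c` is a lower bound for `vol({ε₀ < -2c} ∩ BZ)` (`measurePreserving_momentum_prod`).

These are the tools of the certified LOWER filling bound `n(-3/20) ≥ 9/10` (inscribed polygon) of the
companion file `KLProgrammeMuOfDopingWindowFillingLower.lean`. Folklore; no definitions.
-/

noncomputable section

set_option linter.dupNamespace false

namespace Summit.HubbardSuperconductivity.HubbardSuperconductivity.Theorems

open MeasureTheory Set Literature.MathematicalPhysics.QuantumLattice

/-! ### Concavity of `log cos` and convexity of the Fermi sea -/

/-- `log ∘ cos` is concave on `(-π/2, π/2)` (its derivative `-tan` is antitone there). [folklore] -/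
theorem muWin_concaveOn_log_cos :
    ConcaveOn ℝ (Ioo (-(Real.pi / 2)) (Real.pi / 2)) (fun u => Real.log (Real.cos u)) := by
  have hD : Convex ℝ (Ioo (-(Real.pi / 2)) (Real.pi / 2)) := convex_Ioo _ _
  have hderiv : ∀ x ∈ Ioo (-(Real.pi / 2)) (Real.pi / 2),
      HasDerivAt (fun u => Real.log (Real.cos u)) (-Real.tan x) x := by
    intro x hx
    have hc : Real.cos x ≠ 0 := (Real.cos_pos_of_mem_Ioo hx).ne'
    have := (Real.hasDerivAt_cos x).log hc
    convert this using 1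
    rw [Real.tan_eq_sin_div_cos]; ring
  refine AntitoneOn.concaveOn_of_deriv hD ?_ ?_ ?_
  · exact ContinuousOn.log Real.continuous_cos.continuousOn
      fun x hx => (Real.cos_pos_of_mem_Ioo hx).ne'
  · rw [interior_Ioo]; intro x hx; exact (hderiv x hx).differentiableAt.differentiableWithinAt
  · rw [interior_Ioo]
    intro x hx y hy hxy
    rw [(hderiv x hx).deriv, (hderiv y hy).deriv]
    exact neg_le_neg (Real.strictMonoOn_tan.monotoneOn hx hy hxy)

/-- The open diamond `{|x + y| < π, |x - y| < π}` is convex. [folklore] -/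
theorem muWin_convex_diamond :
    Convex ℝ {q : ℝ × ℝ | |q.1 + q.2| < Real.pi ∧ |q.1 - q.2| < Real.pi} := by
  have h1 : Convex ℝ {q : ℝ × ℝ | |q.1 + q.2| < Real.pi} := by
    have : {q : ℝ × ℝ | |q.1 + q.2| < Real.pi} =
        (LinearMap.fst ℝ ℝ ℝ + LinearMap.snd ℝ ℝ ℝ) ⁻¹' Ioo (-Real.pi) Real.pi := by
      ext q; simp [abs_lt]
    rw [this]; exact (convex_Ioo _ _).linear_preimage _
  have h2 : Convex ℝ {q : ℝ × ℝ | |q.1 - q.2| < Real.pi} := by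
    have : {q : ℝ × ℝ | |q.1 - q.2| < Real.pi} =
        (LinearMap.fst ℝ ℝ ℝ - LinearMap.snd ℝ ℝ ℝ) ⁻¹' Ioo (-Real.pi) Real.pi := by
      ext q; simp [abs_lt]
    rw [this]; exact (convex_Ioo _ _).linear_preimage _
  have : {q : ℝ × ℝ | |q.1 + q.2| < Real.pi ∧ |q.1 - q.2| < Real.pi} =
      {q : ℝ × ℝ | |q.1 + q.2| < Real.pi} ∩ {q : ℝ × ℝ | |q.1 - q.2| < Real.pi} := by
    ext q; simp
  rw [this]; exact h1.inter h2

/-- The concave function `log cos ((x+y)/2) + log cos ((x-y)/2)` on the open diamond. [folklore] -/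
theorem muWin_concaveOn_logProd :
    ConcaveOn ℝ {q : ℝ × ℝ | |q.1 + q.2| < Real.pi ∧ |q.1 - q.2| < Real.pi}
      (fun q : ℝ × ℝ => Real.log (Real.cos ((q.1 + q.2) / 2)) + Real.log (Real.cos ((q.1 - q.2) / 2))) := by
  set L1 : ℝ × ℝ →ₗ[ℝ] ℝ := (1 / 2 : ℝ) • (LinearMap.fst ℝ ℝ ℝ + LinearMap.snd ℝ ℝ ℝ) with hL1
  set L2 : ℝ × ℝ →ₗ[ℝ] ℝ := (1 / 2 : ℝ) • (LinearMap.fst ℝ ℝ ℝ - LinearMap.snd ℝ ℝ ℝ) with hL2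
  have hL1a : ∀ q : ℝ × ℝ, L1 q = (q.1 + q.2) / 2 := by intro q; simp [hL1]; ring
  have hL2a : ∀ q : ℝ × ℝ, L2 q = (q.1 - q.2) / 2 := by intro q; simp [hL2]; ring
  have h1 := muWin_concaveOn_log_cos.comp_linearMap L1
  have h2 := muWin_concaveOn_log_cos.comp_linearMap L2
  have hsub1 : {q : ℝ × ℝ | |q.1 + q.2| < Real.pi ∧ |q.1 - q.2| < Real.pi} ⊆
      L1 ⁻¹' Ioo (-(Real.pi / 2)) (Real.pi / 2) := by
    intro q hq; have := abs_lt.1 hq.1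
    simp only [mem_preimage, hL1a, mem_Ioo]; constructor <;> linarith
  have hsub2 : {q : ℝ × ℝ | |q.1 + q.2| < Real.pi ∧ |q.1 - q.2| < Real.pi} ⊆
      L2 ⁻¹' Ioo (-(Real.pi / 2)) (Real.pi / 2) := by
    intro q hq; have := abs_lt.1 hq.2
    simp only [mem_preimage, hL2a, mem_Ioo]; constructor <;> linarith
  have h1' := h1.subset hsub1 muWin_convex_diamond
  have h2' := h2.subset hsub2 muWin_convex_diamond
  have h := h1'.add h2'
  refine h.congr ?_
  intro q _
  simp only [Pi.add_apply, Function.comp_apply, hL1a, hL2a]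

/-- **The free Fermi sea below half filling is convex.** For `c > 0` the set
`R_c = {(x, y) | |x + y| < π, |x - y| < π, c < cos x + cos y}` (the Fermi sea `{ε₀ < -2c} ∩ BZ` in
coordinates) is convex: it is the superlevel set `{log (c/2) < log cos u + log cos v}` of a concave function
of `u = (x+y)/2`, `v = (x-y)/2`. [folklore] -/
theorem convex_fermiSeaCoord {c : ℝ} (hc : 0 < c) :
    Convex ℝ {q : ℝ × ℝ | |q.1 + q.2| < Real.pi ∧ |q.1 - q.2| < Real.pi ∧
      c < Real.cos q.1 + Real.cos q.2} := by
  have h := muWin_concaveOn_logProd.convex_gt (Real.log (c / 2))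
  have hset : {q : ℝ × ℝ | |q.1 + q.2| < Real.pi ∧ |q.1 - q.2| < Real.pi ∧
      c < Real.cos q.1 + Real.cos q.2} =
      {q : ℝ × ℝ | q ∈ {q : ℝ × ℝ | |q.1 + q.2| < Real.pi ∧ |q.1 - q.2| < Real.pi} ∧
        Real.log (c / 2) <
          Real.log (Real.cos ((q.1 + q.2) / 2)) + Real.log (Real.cos ((q.1 - q.2) / 2))} := by
    refine Set.ext fun q => ?_
    simp only [mem_setOf_eq]
    constructor
    · rintro ⟨h1, h2, h3⟩
      refine ⟨⟨h1, h2⟩, ?_⟩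
      have hu : 0 < Real.cos ((q.1 + q.2) / 2) :=
        Real.cos_pos_of_mem_Ioo ⟨by linarith [(abs_lt.1 h1).1], by linarith [(abs_lt.1 h1).2]⟩
      have hv : 0 < Real.cos ((q.1 - q.2) / 2) :=
        Real.cos_pos_of_mem_Ioo ⟨by linarith [(abs_lt.1 h2).1], by linarith [(abs_lt.1 h2).2]⟩
      rw [← Real.log_mul hu.ne' hv.ne']
      refine Real.log_lt_log (by positivity) ?_
      have := Real.cos_add_cos q.1 q.2
      nlinarith
    · rintro ⟨⟨h1, h2⟩, h3⟩
      refine ⟨h1, h2, ?_⟩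
      have hu : 0 < Real.cos ((q.1 + q.2) / 2) :=
        Real.cos_pos_of_mem_Ioo ⟨by linarith [(abs_lt.1 h1).1], by linarith [(abs_lt.1 h1).2]⟩
      have hv : 0 < Real.cos ((q.1 - q.2) / 2) :=
        Real.cos_pos_of_mem_Ioo ⟨by linarith [(abs_lt.1 h2).1], by linarith [(abs_lt.1 h2).2]⟩
      rw [← Real.log_mul hu.ne' hv.ne'] at h3
      have h4 : c / 2 < Real.cos ((q.1 + q.2) / 2) * Real.cos ((q.1 - q.2) / 2) :=
        (Real.log_lt_log_iff (by positivity) (mul_pos hu hv)).1 h3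
      rw [Real.cos_add_cos]
      linarith
  rw [hset]
  exact h

/-- Symmetries of `R_c`: `(x, y) ↦ (-x, y)`. [folklore] -/
theorem fermiSeaCoord_neg_fst {c x y : ℝ}
    (h : (x, y) ∈ {q : ℝ × ℝ | |q.1 + q.2| < Real.pi ∧ |q.1 - q.2| < Real.pi ∧
      c < Real.cos q.1 + Real.cos q.2}) :
    (-x, y) ∈ {q : ℝ × ℝ | |q.1 + q.2| < Real.pi ∧ |q.1 - q.2| < Real.pi ∧
      c < Real.cos q.1 + Real.cos q.2} := by
  obtain ⟨h1, h2, h3⟩ := h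
  refine ⟨?_, ?_, ?_⟩
  · rw [show -x + y = -(x - y) by ring, abs_neg]; exact h2
  · rw [show -x - y = -(x + y) by ring, abs_neg]; exact h1
  · simpa only [Real.cos_neg] using h3

/-- Symmetries of `R_c`: `(x, y) ↦ (x, -y)`. [folklore] -/
theorem fermiSeaCoord_neg_snd {c x y : ℝ}
    (h : (x, y) ∈ {q : ℝ × ℝ | |q.1 + q.2| < Real.pi ∧ |q.1 - q.2| < Real.pi ∧
      c < Real.cos q.1 + Real.cos q.2}) :
    (x, -y) ∈ {q : ℝ × ℝ | |q.1 + q.2| < Real.pi ∧ |q.1 - q.2| < Real.pi ∧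
      c < Real.cos q.1 + Real.cos q.2} := by
  obtain ⟨h1, h2, h3⟩ := h
  refine ⟨?_, ?_, ?_⟩
  · rw [show x + -y = x - y by ring]; exact h2
  · rw [show x - -y = x + y by ring]; exact h1
  · simpa only [Real.cos_neg] using h3

/-- Symmetries of `R_c`: `(x, y) ↦ (y, x)`. [folklore] -/
theorem fermiSeaCoord_swap {c x y : ℝ}
    (h : (x, y) ∈ {q : ℝ × ℝ | |q.1 + q.2| < Real.pi ∧ |q.1 - q.2| < Real.pi ∧
      c < Real.cos q.1 + Real.cos q.2}) :
    (y, x) ∈ {q : ℝ × ℝ | |q.1 + q.2| < Real.pi ∧ |q.1 - q.2| < Real.pi ∧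
      c < Real.cos q.1 + Real.cos q.2} := by
  obtain ⟨h1, h2, h3⟩ := h
  refine ⟨?_, ?_, ?_⟩
  · rw [add_comm]; exact h1
  · rw [show y - x = -(x - y) by ring, abs_neg]; exact h2
  · rw [add_comm]; exact h3

/-- Membership in `R_c` from the planar data `|x| + |y| < π` and `c < cos x + cos y`. [folklore] -/
theorem mem_fermiSeaCoord {c x y : ℝ} (hxy : |x| + |y| < Real.pi) (hc : c < Real.cos x + Real.cos y) :
    (x, y) ∈ {q : ℝ × ℝ | |q.1 + q.2| < Real.pi ∧ |q.1 - q.2| < Real.pi ∧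
      c < Real.cos q.1 + Real.cos q.2} :=
  ⟨lt_of_le_of_lt (abs_add_le x y) hxy,
    lt_of_le_of_lt (by simpa only [sub_eq_add_neg, abs_neg] using abs_add_le x (-y)) hxy, hc⟩

/-! ### Inscribed symmetric trapezoids -/

/-- **A symmetric trapezoid with corners in a convex set lies in it.** For `x₀ < x₁` and the affine `g`
with `g x₀ = y₀`, `g x₁ = y₁`: if `(x₀, ±y₀), (x₁, ±y₁) ∈ R` and `R` is convex then
`{(x, y) | x ∈ (x₀, x₁], |y| < g x} ⊆ R`. [folklore] -/
theorem trapezoid_subset_of_convex {R : Set (ℝ × ℝ)} (hR : Convex ℝ R) {x₀ x₁ y₀ y₁ : ℝ}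
    (hx : x₀ < x₁) (h₀ : (x₀, y₀) ∈ R) (h₀' : (x₀, -y₀) ∈ R) (h₁ : (x₁, y₁) ∈ R)
    (h₁' : (x₁, -y₁) ∈ R) :
    regionBetween (fun x => -(y₀ + (y₁ - y₀) / (x₁ - x₀) * (x - x₀)))
      (fun x => y₀ + (y₁ - y₀) / (x₁ - x₀) * (x - x₀)) (Ioc x₀ x₁) ⊆ R := by
  rintro ⟨x, y⟩ ⟨⟨hx0, hx1⟩, hylo, hyhi⟩
  simp only at hylo hyhi hx0 hx1
  have hd : x₁ - x₀ ≠ 0 := sub_ne_zero.2 hx.ne'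
  set θ : ℝ := (x - x₀) / (x₁ - x₀) with hθ
  have hθ0 : 0 ≤ θ := div_nonneg (by linarith) (by linarith)
  have hθ1 : θ ≤ 1 := (div_le_one (by linarith)).2 (by linarith)
  set g : ℝ := y₀ + (y₁ - y₀) / (x₁ - x₀) * (x - x₀) with hg
  have hgθ : g = (1 - θ) * y₀ + θ * y₁ := by
    rw [hg, hθ]; field_simp; ring
  have hxθ : x = (1 - θ) * x₀ + θ * x₁ := by
    rw [hθ]; field_simp; ring
  have hgpos : 0 < g := by linarith
  -- the two points `(x, ±g)` on the slanted edges
  have htop : ((x, g) : ℝ × ℝ) ∈ R := by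
    have := hR h₀ h₁ (sub_nonneg.2 hθ1) hθ0 (by ring)
    convert this using 1
    ext <;> simp [hxθ, hgθ]
  have hbot : ((x, -g) : ℝ × ℝ) ∈ R := by
    have := hR h₀' h₁' (sub_nonneg.2 hθ1) hθ0 (by ring)
    convert this using 1
    ext <;> simp [hxθ, hgθ]; ring
  -- `(x, y)` on the vertical segment between them
  set a : ℝ := (g + y) / (2 * g) with ha
  set b : ℝ := (g - y) / (2 * g) with hb
  have ha0 : 0 ≤ a := div_nonneg (by linarith) (by linarith)
  have hb0 : 0 ≤ b := div_nonneg (by linarith) (by linarith)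
  have hab : a + b = 1 := by rw [ha, hb]; field_simp; ring
  have := hR htop hbot ha0 hb0 hab
  convert this using 1
  ext
  · simp only [Prod.fst_add, Prod.smul_fst, smul_eq_mul]
    calc x = (a + b) * x := by rw [hab, one_mul]
      _ = a * x + b * x := by ring
  · simp only [Prod.snd_add, Prod.smul_snd, smul_eq_mul]
    rw [ha, hb]; field_simp; ring

/-- Measurability of the symmetric trapezoid. [folklore] -/
theorem measurableSet_trapezoid (x₀ x₁ y₀ y₁ : ℝ) :
    MeasurableSet (regionBetween (fun x => -(y₀ + (y₁ - y₀) / (x₁ - x₀) * (x - x₀)))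
      (fun x => y₀ + (y₁ - y₀) / (x₁ - x₀) * (x - x₀)) (Ioc x₀ x₁)) :=
  measurableSet_regionBetween (by fun_prop) (by fun_prop) measurableSet_Ioc

/-- **Area of the symmetric trapezoid**: `(x₁ - x₀)(y₀ + y₁)` for `x₀ < x₁`, `y₀, y₁ ≥ 0`. [folklore] -/
theorem volume_trapezoid {x₀ x₁ y₀ y₁ : ℝ} (hx : x₀ < x₁) (hy₀ : 0 ≤ y₀) (hy₁ : 0 ≤ y₁) :
    volume (regionBetween (fun x => -(y₀ + (y₁ - y₀) / (x₁ - x₀) * (x - x₀)))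
      (fun x => y₀ + (y₁ - y₀) / (x₁ - x₀) * (x - x₀)) (Ioc x₀ x₁)) =
      ENNReal.ofReal ((x₁ - x₀) * (y₀ + y₁)) := by
  have hd : x₁ - x₀ ≠ 0 := sub_ne_zero.2 hx.ne'
  have hgnn : ∀ x ∈ Ioc x₀ x₁, 0 ≤ y₀ + (y₁ - y₀) / (x₁ - x₀) * (x - x₀) := by
    intro x hx'
    have heq : y₀ + (y₁ - y₀) / (x₁ - x₀) * (x - x₀) = ((x₁ - x) * y₀ + (x - x₀) * y₁) / (x₁ - x₀) := by
      field_simp; ring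
    rw [heq]
    exact div_nonneg (add_nonneg (mul_nonneg (by linarith [hx'.2]) hy₀)
      (mul_nonneg (by linarith [hx'.1]) hy₁)) (by linarith)
  rw [Measure.volume_eq_prod, volume_regionBetween_eq_integral
    (Continuous.integrableOn_Ioc (by fun_prop)) (Continuous.integrableOn_Ioc (by fun_prop))
    measurableSet_Ioc (fun x hx' => by linarith [hgnn x hx'])]
  congr 1
  have hfun : ((fun x : ℝ => y₀ + (y₁ - y₀) / (x₁ - x₀) * (x - x₀)) -
      fun x : ℝ => -(y₀ + (y₁ - y₀) / (x₁ - x₀) * (x - x₀))) =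
      fun x => (2 * y₀ - 2 * ((y₁ - y₀) / (x₁ - x₀)) * x₀) + (2 * ((y₁ - y₀) / (x₁ - x₀))) * x := by
    funext x
    simp only [Pi.sub_apply]
    ring
  rw [hfun, ← intervalIntegral.integral_of_le hx.le,
    intervalIntegral.integral_add intervalIntegrable_const
      (Continuous.intervalIntegrable (by fun_prop) _ _),
    intervalIntegral.integral_const, intervalIntegral.integral_const_mul, integral_id, smul_eq_mul]
  field_simp
  ring

/-- **Disjoint-union bookkeeping.** If `U ⊆ R` lies over `{x ≤ s}` with volume `a` and the measurable
`P ⊆ R` lies over `(s, t]` with volume `b`, then `U ∪ P ⊆ R` lies over `{x ≤ t}` and has volume `a + b`.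
[folklore] -/
theorem trapezoid_union_step {R U P : Set (ℝ × ℝ)} {s t a b : ℝ} (hUR : U ⊆ R)
    (hUs : U ⊆ {q : ℝ × ℝ | q.1 ≤ s}) (hvolU : volume U = ENNReal.ofReal a) (ha : 0 ≤ a)
    (hPR : P ⊆ R) (hP : P ⊆ Ioc s t ×ˢ (univ : Set ℝ)) (hPm : MeasurableSet P)
    (hvolP : volume P = ENNReal.ofReal b) (hb : 0 ≤ b) (hst : s ≤ t) :
    U ∪ P ⊆ R ∧ U ∪ P ⊆ {q : ℝ × ℝ | q.1 ≤ t} ∧ volume (U ∪ P) = ENNReal.ofReal (a + b) ∧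
      0 ≤ a + b := by
  refine ⟨union_subset hUR hPR, ?_, ?_, add_nonneg ha hb⟩
  · rintro q (hq | hq)
    · exact le_trans (hUs hq) hst
    · exact ((hP hq).1).2
  · have hdisj : Disjoint U P := by
      rw [Set.disjoint_left]
      intro q hqU hqP
      have h1 : q.1 ≤ s := hUs hqU
      have h2 : s < q.1 := ((hP hqP).1).1
      exact lt_irrefl _ (lt_of_le_of_lt h1 h2)
    rw [measure_union hdisj hPm, hvolU, hvolP, ENNReal.ofReal_add ha hb]

/-- A trapezoid over `(x₀, x₁]` lies over `{x ≤ x₁}` (start of the bookkeeping). [folklore] -/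
theorem trapezoid_subset_halfplane (f g : ℝ → ℝ) (x₀ x₁ : ℝ) :
    regionBetween f g (Ioc x₀ x₁) ⊆ {q : ℝ × ℝ | q.1 ≤ x₁} :=
  fun _ hq => ((regionBetween_subset f g _ hq).1).2

/-! ### Transport to momentum space -/

/-- **`R_c` is the Fermi sea in coordinates**: a momentum whose coordinate pair lies in `R_c` is occupied
at energy `-2c` and lies in the Brillouin zone. [folklore] -/
theorem preimage_fermiSeaCoord_subset (c : ℝ) :
    (fun k : Momentum => ((k 0, k 1) : ℝ × ℝ)) ⁻¹'
        {q : ℝ × ℝ | |q.1 + q.2| < Real.pi ∧ |q.1 - q.2| < Real.pi ∧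
          c < Real.cos q.1 + Real.cos q.2} ⊆
      {p : Momentum | squareDispersion 1 0 p < -2 * c} ∩ brillouinZone := by
  intro p hp
  simp only [mem_preimage, mem_setOf_eq] at hp
  obtain ⟨h1, h2, h3⟩ := hp
  have ha := abs_lt.1 h1
  have hb := abs_lt.1 h2
  refine ⟨?_, ?_⟩
  · simp only [mem_setOf_eq, squareDispersion]
    linarith
  · intro i
    fin_cases i
    · show p 0 ∈ Ico (-Real.pi) Real.pi
      exact ⟨by linarith, by linarith⟩
    · show p 1 ∈ Ico (-Real.pi) Real.pi
      exact ⟨by linarith, by linarith⟩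

/-- `R_c` is measurable (it is open). [folklore] -/
theorem measurableSet_fermiSeaCoord (c : ℝ) :
    MeasurableSet {q : ℝ × ℝ | |q.1 + q.2| < Real.pi ∧ |q.1 - q.2| < Real.pi ∧
      c < Real.cos q.1 + Real.cos q.2} := by
  have h : {q : ℝ × ℝ | |q.1 + q.2| < Real.pi ∧ |q.1 - q.2| < Real.pi ∧
      c < Real.cos q.1 + Real.cos q.2} =
      {q : ℝ × ℝ | |q.1 + q.2| < Real.pi} ∩ ({q : ℝ × ℝ | |q.1 - q.2| < Real.pi} ∩
        {q : ℝ × ℝ | c < Real.cos q.1 + Real.cos q.2}) := by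
    ext q; simp
  rw [h]
  refine (measurableSet_lt (by fun_prop) (by fun_prop)).inter
    ((measurableSet_lt (by fun_prop) (by fun_prop)).inter (measurableSet_lt (by fun_prop) (by fun_prop)))

/-- **Lower bounds transport**: the volume of `R_c` bounds the occupied volume at energy `-2c` from below
(`measurePreserving_momentum_prod`). [folklore] -/
theorem volume_fermiSeaCoord_le (c : ℝ) :
    volume {q : ℝ × ℝ | |q.1 + q.2| < Real.pi ∧ |q.1 - q.2| < Real.pi ∧
        c < Real.cos q.1 + Real.cos q.2} ≤
      volume ({p : Momentum | squareDispersion 1 0 p < -2 * c} ∩ brillouinZone) := by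
  rw [← measurePreserving_momentum_prod.measure_preimage
    (measurableSet_fermiSeaCoord c).nullMeasurableSet]
  exact measure_mono (preimage_fermiSeaCoord_subset c)

end Summit.HubbardSuperconductivity.HubbardSuperconductivity.Theorems

end
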